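import Literature.Computability.Complexity.MurrayWilliams2018Lemma13QP
import HarnessLib

/-!
# Murray–Williams 2018, Theorem 1.2 for `AC⁰[m]`: the exponential-level simulation may use the
# `AC⁰[m]`-SAT algorithms of EVERY depth

Glue layer under the named fact `MurrayWilliams2018_thm_1_2_acc` (`MurrayWilliams2018.lean`;
C. D. Murray, R. R. Williams, *Circuit lower bounds for nondeterministic quasi-polytime: an easy
witness lemma for NP and NQP*, STOC 2018, Thm. 1.2 for the classes `AC⁰[m]`). The assembly
`MurrayWilliams2018_thm_1_2_acc_of_EWL_of_expSimulation` (`MurrayWilliams2018ExpLevel.lean`) hands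
its simulation hypothesis `hN` the `AC⁰[m]`-SAT algorithm of ONE depth `d + c₀`, `c₀` fixed before
`d` — the shape of the source's §5 simulation, whose single SAT call is on the EVAL-GATE
consistency circuit `D` of depth `d + O(1)`. The hypothesis of `MurrayWilliams2018_thm_1_2_acc`,
however, provides the algorithms of EVERY depth (`∀ d', ∃ r ≥ 2, AccSatSubexp d' m r` — exactly what
Thm. 5.1, `MurrayWilliams2018_thm_5_1_holds`, gives), and a simulation in the manner of WILLIAMS'
proof of his Thm. 3.2 (J. ACM 2014: the generator `A` of Lemma 3.1 checks its guessed circuits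
through the `ACC` CIRCUIT SAT instances VALUE and EQUIV, of depth `2d + O(1)`, before the machine
`B` runs) needs SAT calls at depths that are not `d + O(1)`. This file therefore proves the same
assembly for a simulation hypothesis receiving ALL depths:

* **`MurrayWilliams2018_thm_1_2_acc_of_EWL_of_expSimulationAllDepths`** — Thm. 1.2 for `AC⁰[m]`
  from `hEWL` (Lemma 1.3 at the tree's levels, verbatim) and
  `hN' : ∀ d m k, 2 ≤ m → 1 ≤ k → (∀ d', ∃ r ≥ 2, AccSatSubexp d' m r) →
        (P ⊆ ⋃ₐ DepthSizeClass (accBasis m) d (a · 2^{(log₂ n)^k} + a)) →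
        ∃ q ≥ 1, ∀ L ∈ NTIME (2 ^ ·), HasWitnessCircuits (2^{n³}) L (2^{⌊n^{1/q}⌋}) → L ∈ NTIME williamsBound`;
  the proof is that of `MurrayWilliams2018_thm_1_2_acc_of_EWL_of_expSimulation` word for word
  (assumption (A), unrestricted circuits a.e., witness circuits at all levels, `P`'s circuits,
  the hard language of the PROVED hierarchy theorem padded subexponentially into a level,
  witnesses pulled back to the `2^{n³}`-verifiers with size `2^{⌊N^{1/q}⌋}`), the only change being
  that the whole family of SAT algorithms is passed to the simulation;
* `MurrayWilliams2018_thm_1_2_acc_of_lemma_4_1_qp_of_expSimulationAllDepths` — the same over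
  Lemma 4.1 in polylogarithmic-seed form (`MurrayWilliams2018_lemma_1_3_of_lemma_4_1_qp`,
  `MurrayWilliams2018Lemma13QP.lean`);
* `expSimulation_of_allDepths`-direction sanity: the all-depths hypothesis is WEAKER than `hN`
  (`expSimulationAllDepths_of_expSimulation`: a one-depth simulation is an all-depths one).

Theorems only; no definition and no named fact is introduced (the simulation is an inline
hypothesis, D-0026).

## References

* C. D. Murray, R. R. Williams, *Circuit lower bounds for nondeterministic quasi-polytime: an
  easy witness lemma for NP and NQP*, STOC 2018, 890–901, Thm. 1.2 and its proof (§5), Thm. 5.1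
  [MurrayWilliams2018].
* R. Williams, *Nonuniform ACC circuit lower bounds*, J. ACM 61 (2014) 2:1–2:32, Lemma 3.1
  (VALUE, EQUIV), proof of Thm. 3.2 [Williams2014].
* S. Arora, B. Barak, *Computational Complexity: A Modern Approach*, CUP 2009, §2.6.2 (padding),
  Thm. 3.2 (nondeterministic time hierarchy) [AroraBarak2009].
-/

namespace Literature.Computability.Complexity

open Filter

/-- **A one-depth simulation is an all-depths simulation**: the hypothesis `hN` of
`MurrayWilliams2018_thm_1_2_acc_of_EWL_of_expSimulation` implies the all-depths hypothesis `hN'`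
below (take the algorithm of depth `d + c₀`). [folklore] -/
theorem expSimulationAllDepths_of_expSimulation
    (hN : ∃ c₀ : ℕ, ∀ (d m k r : ℕ), 2 ≤ m → 1 ≤ k → 2 ≤ r →
      AccSatSubexp (d + c₀) m r →
      (Classes.P ⊆ ⋃ a : ℕ,
          DepthSizeClass (accBasis m) (fun _ => d) (fun n => a * 2 ^ Nat.log 2 n ^ k + a)) →
      ∃ q : ℕ, 1 ≤ q ∧ ∀ L ∈ NTIME (fun n => 2 ^ n),
        HasWitnessCircuits (fun n => 2 ^ (n ^ 3)) L (fun n => 2 ^ Nat.nthRoot q n) →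
        L ∈ NTIME williamsBound) :
    ∀ (d m k : ℕ), 2 ≤ m → 1 ≤ k → (∀ d' : ℕ, ∃ r : ℕ, 2 ≤ r ∧ AccSatSubexp d' m r) →
      (Classes.P ⊆ ⋃ a : ℕ,
          DepthSizeClass (accBasis m) (fun _ => d) (fun n => a * 2 ^ Nat.log 2 n ^ k + a)) →
      ∃ q : ℕ, 1 ≤ q ∧ ∀ L ∈ NTIME (fun n => 2 ^ n),
        HasWitnessCircuits (fun n => 2 ^ (n ^ 3)) L (fun n => 2 ^ Nat.nthRoot q n) →
        L ∈ NTIME williamsBound := by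
  obtain ⟨c₀, hN⟩ := hN
  intro d m k hm hk hsat hP
  obtain ⟨r, hr, hS⟩ := hsat (d + c₀)
  exact hN d m k r hm hk hr hS hP

/-- **Assembly of Murray–Williams' Theorem 1.2 (for `AC⁰[m]`) over an exponential-level simulation
that may call the `AC⁰[m]`-SAT algorithms of every depth.** As
`MurrayWilliams2018_thm_1_2_acc_of_EWL_of_expSimulation` (`MurrayWilliams2018ExpLevel.lean`), whose
proof this is word for word, except that the simulation hypothesis `hN'` receives the whole family
`∀ d', ∃ r ≥ 2, AccSatSubexp d' m r` of the theorem's hypothesis instead of the algorithm of the one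
depth `d + c₀`. [cite: MurrayWilliams2018, Thm. 1.2 (proof, §5) and Remark 1] -/
theorem MurrayWilliams2018_thm_1_2_acc_of_EWL_of_expSimulationAllDepths
    (hEWL : ∀ k : ℕ, 1 ≤ k →
      (∀ e : ℕ, 1 ≤ e → ∀ L ∈ NTIME (fun n => n ^ Nat.log 2 n ^ e),
          ∀ᶠ n in atTop, L.circuitSize n ≤ 2 ^ Nat.log 2 n ^ k) →
        ∃ K e₀ : ℕ, 1 ≤ K ∧ ∀ e : ℕ, e₀ ≤ e →
          NTIMEHasWitnessCircuits (fun n => n ^ Nat.log 2 n ^ e) (fun n => 2 ^ Nat.log 2 n ^ K))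
    (hN' : ∀ (d m k : ℕ), 2 ≤ m → 1 ≤ k → (∀ d' : ℕ, ∃ r : ℕ, 2 ≤ r ∧ AccSatSubexp d' m r) →
      (Classes.P ⊆ ⋃ a : ℕ,
          DepthSizeClass (accBasis m) (fun _ => d) (fun n => a * 2 ^ Nat.log 2 n ^ k + a)) →
      ∃ q : ℕ, 1 ≤ q ∧ ∀ L ∈ NTIME (fun n => 2 ^ n),
        HasWitnessCircuits (fun n => 2 ^ (n ^ 3)) L (fun n => 2 ^ Nat.nthRoot q n) →
        L ∈ NTIME williamsBound) :
    MurrayWilliams2018_thm_1_2_acc := by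
  intro d m hm hsat k
  by_contra hcon
  -- (A): every language of every level `e ≥ 1` has small depth-`d` `AC⁰[m]` circuits
  have hA : ∀ e : ℕ, 1 ≤ e → ∀ L ∈ NTIME (fun n => n ^ Nat.log 2 n ^ e), ∃ c : ℕ,
      L ∈ DepthSizeClass (accBasis m) (fun _ => d) (fun n => c * 2 ^ Nat.log 2 n ^ k + c) := by
    intro e he L hL
    by_contra h
    exact hcon ⟨e, he, L, hL, fun c hc => h ⟨c, hc⟩⟩
  -- (i) unrestricted circuits of size `2^{(log n)^{k+2}}` almost everywhere
  have hSIZE : ∀ e : ℕ, 1 ≤ e → ∀ L ∈ NTIME (fun n => n ^ Nat.log 2 n ^ e),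
      ∀ᶠ n in atTop, L.circuitSize n ≤ 2 ^ Nat.log 2 n ^ (k + 2) := by
    intro e he L hL
    obtain ⟨c, hc⟩ := hA e he L hL
    exact eventually_circuitSize_le_of_mem_depthSizeClass hm hc
  -- (ii) witness circuits (Lemma 1.3 at exponent `k + 2`)
  obtain ⟨K, e₀, hK1, he₀⟩ := hEWL (k + 2) (by omega) hSIZE
  -- (iii) `P` has the assumed circuits (exponent `k + 1 ≥ 1`)
  have hP : Classes.P ⊆ ⋃ a : ℕ,
      DepthSizeClass (accBasis m) (fun _ => d) (fun n => a * 2 ^ Nat.log 2 n ^ (k + 1) + a) := by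
    intro L hL
    obtain ⟨c, hc⟩ := hA 1 le_rfl L (P_subset_NTIME_pow_log hL)
    exact Set.mem_iUnion.2 ⟨2 * c, DepthSizeClass_mono le_rfl (fun _ => le_rfl)
      (fun n => mul_two_pow_log_pow_le_succ c k n) hc⟩
  -- (iv) the simulation names its witness-size exponent `q`, given ALL the SAT algorithms
  obtain ⟨q, hq, hNq⟩ := hN' d m (k + 1) hm (by omega) hsat hP
  -- (v) the hard language of the PROVED hierarchy theorem, at the exponential level
  obtain ⟨L₁, hL₁, hL₁w⟩ := exists_mem_NTIME_two_pow_not_mem_williamsBound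
  -- (vi) padding parameter `q' = 2Kq` and level `e = max e₀ (6 q')`
  have hq'0 : 2 * K * q ≠ 0 := by positivity
  obtain ⟨e, he⟩ : ∃ e : ℕ, e = max e₀ (6 * (2 * K * q)) := ⟨_, rfl⟩
  have he6 : 2 * 3 * (2 * K * q) ≤ e + 1 := by omega
  have he2 : 2 * 1 * (2 * K * q) ≤ e + 1 := by omega
  have he1 : 1 ≤ e := by omega
  have hL₁' : L₁ ∈ NTIME (fun n => 2 ^ (n ^ 1)) := by simpa only [pow_one] using hL₁
  have hpad : padLangQ (2 * K * q) L₁ ∈ NTIME (fun n => n ^ Nat.log 2 n ^ e) :=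
    padLangQ_mem_NTIME_level le_rfl he2 he1 hL₁'
  -- (vii) witness circuits at the level `e`, brought back to the `2^{n³}`-verifiers of `L₁`
  have hw : HasWitnessCircuits (fun n => n ^ Nat.log 2 n ^ e) (padLangQ (2 * K * q) L₁)
      (fun n => 2 ^ Nat.log 2 n ^ K) := he₀ e (he ▸ le_max_left _ _) _ hpad
  have hw3 := hw.of_padLangQ (j := 3) (by norm_num) hq'0 he6 he1
  have hw3' : HasWitnessCircuits (fun n => 2 ^ (n ^ 3)) L₁ (fun n => 2 ^ Nat.nthRoot q n) :=
    hw3.mono ((eventually_log_padLenQ_pow_le hK1 hq).mono fun N hN =>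
      Nat.pow_le_pow_right two_pos hN)
  -- (viii) the simulation puts `L₁` in `NTIME williamsBound`: contradiction
  exact hL₁w (hNq L₁ hL₁ hw3')

/-- **Theorem 1.2 for `AC⁰[m]` from Lemma 4.1 in polylogarithmic-seed form and an all-depths
exponential-level simulation** (`MurrayWilliams2018_lemma_1_3_of_lemma_4_1_qp`).
[cite: MurrayWilliams2018, Thm. 1.2 (proof, §5)] -/
theorem MurrayWilliams2018_thm_1_2_acc_of_lemma_4_1_qp_of_expSimulationAllDepths
    (hQ : ∃ e g d C : ℕ, 1 ≤ e ∧ 1 ≤ g ∧ 1 ≤ d ∧ 1 ≤ C ∧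
      ∀ (s t T : ℕ → ℕ), StrictMono s → IsTimeConstructible s → IsTimeConstructible t →
        Monotone t → IsTimeConstructible T → Monotone T →
        (∀ᶠ n in atTop, n * s n < 2 ^ (n / e)) →
        (∀ᶠ n in atTop, ((stretch s e)^[3] n) ^ d ≤ t n) →
        (∀ᶠ n in atTop, 2 ^ (C * (Nat.log 2 (t n) + 2) ^ C) ≤ T n) →
        (∀ L ∈ NTIME T, ∀ᶠ n in atTop, L.circuitSize n ≤ s n) →
          NTIMEHasWitnessCircuits t (fun n => ((stretch s e)^[3] n) ^ (2 * g)))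
    (hN' : ∀ (d m k : ℕ), 2 ≤ m → 1 ≤ k → (∀ d' : ℕ, ∃ r : ℕ, 2 ≤ r ∧ AccSatSubexp d' m r) →
      (Classes.P ⊆ ⋃ a : ℕ,
          DepthSizeClass (accBasis m) (fun _ => d) (fun n => a * 2 ^ Nat.log 2 n ^ k + a)) →
      ∃ q : ℕ, 1 ≤ q ∧ ∀ L ∈ NTIME (fun n => 2 ^ n),
        HasWitnessCircuits (fun n => 2 ^ (n ^ 3)) L (fun n => 2 ^ Nat.nthRoot q n) →
        L ∈ NTIME williamsBound) :
    MurrayWilliams2018_thm_1_2_acc :=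
  MurrayWilliams2018_thm_1_2_acc_of_EWL_of_expSimulationAllDepths
    (MurrayWilliams2018_lemma_1_3_of_lemma_4_1_qp hQ) hN'

end Literature.Computability.Complexity
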